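import Summits.KontsevichZagierPeriods.KontsevichZagierPeriods.Theorems.GrothendieckGpcLegendreLemniscatic

/-!
# Stub `stub_gpcLegendreLemniscatic` of the Legendre sector chain (line cusp-transport, m = 1/2)

Line cusp-transport-to-the-beta-world of the crux `CompleteModGammaSector`
(stmt-KontsevichZagierPeriods-14233) registered, as the `m = 1/2` instance of its Legendre chain
(square change of variables → Elliott cusp transport → integrate out `u` → half-`π` link), the stub
`stub_gpcLegendreLemniscatic : Theses.Grothendieck.GpcLegendreLemniscatic` — Legendre's relation
`2E(1/√2)K(1/√2) − K(1/√2)² = π/2` as a chain of Kontsevich–Zagier moves. Since the registration the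
item (stmt-KontsevichZagierPeriods-0280) was proved independently by the Grothendieck route's line
`hyperbola-fibration-conic` (`GpcLegendreLemniscaticLine.GpcLegendreLemniscatic_proof`, file
`Theorems/GrothendieckGpcLegendreLemniscatic.lean`); this file closes the registration by re-exporting
that theorem under the registered name, in the engine namespace of the cusp line. No new content.
-/

noncomputable section
set_option linter.dupNamespace false

namespace Summit.KontsevichZagierPeriods.KontsevichZagierPeriods.CompleteModGammaSectorEngine

/-- **`stub_gpcLegendreLemniscatic`** — the registered stub of the cusp line's Legendre chain at the
lemniscatic modulus `m = 1/2` (crux `CompleteModGammaSector`, stmt-KontsevichZagierPeriods-14233) is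
the Grothendieck route's theorem `GpcLegendreLemniscatic_proof` (stmt-KontsevichZagierPeriods-0280,
proved): Legendre's relation `2EK − K² = π/2` at `k² = 1/2` as a chain of moves — for every
`r : KZ.IntegralRep 2` on `(0,1)²` with integrand `(2e(x₀) − k(x₀))·k(x₁)` and every
`r' : KZ.IntegralRep 1` on `ℝ` with integrand `1/(2(1+x²))`, `KZ.Equivalent r r'`.
[cite: KontsevichZagier2001, §1.2] -/
theorem stub_gpcLegendreLemniscatic :
    Summit.KontsevichZagierPeriods.KontsevichZagierPeriods.Theses.Grothendieck.GpcLegendreLemniscatic :=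
  Summit.KontsevichZagierPeriods.Grothendieck.GpcLegendreLemniscaticLine.GpcLegendreLemniscatic_proof

end Summit.KontsevichZagierPeriods.KontsevichZagierPeriods.CompleteModGammaSectorEngine
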